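import Summits.Schanuel.Schanuel.Theorems.ZilberEacRelGraphFibreDegenerate
import Mathlib.RingTheory.Polynomial.Eisenstein.Basic
import HarnessLib

/-!
# The exponential-polynomial regime, CXVII: THE ELLIPTIC CURVE `x₁² = x₀³ + 1` — a base curve
# with NO asymptote of rational slope and unequal pole orders — graph fibres involving `y₁`

HONEST FRAMING.  Cell `pub-schanuel` (Zilber's Exponential-Algebraic Closedness, case ladder;
host summit Schanuel), seat 2, gen 34.  The curve `C : x₁² = x₀³ + 1` was the named open example
of HANDOFF O91: its only place at infinity is `x₀ = s^{-2}`, `x₁ = Φ(s)s^{-3}`,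
`Φ = √(1 + s⁶)` (pole orders `2 < 3`, direction `x₁/x₀ → ∞` but NO asymptotic line), so none of
the verdicts of gens 31–33 (bounded branches, rational asymptotes) reach surfaces over it whose
equations involve `y₁`.  The degenerate-direction engine does: `z = √π(1 + i)` has `z² = 2πi`
and `Re(Φ(0)z³) = −2π√π < 0`.  **`unprojectedDensityQuestion_ellipticCurve_relGraphFibre`**:
every graph fibre `{x₁² = x₀³ + 1, y₀ = R(x₀, x₁, y₁)}` with `R(x, 0) ≠ 0` somewhere on `C` and
`R(x, t) ≠ 0` for some `x ∈ C`, `t ≠ 0` is in Mantova–Masser's case AND has Zariski-dense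
unprojected exponential points; **`unprojectedDensityQuestion_ellipticCurve_unitLine`**:
`{x₁² = x₀³ + 1, y₀ + y₁ = 1}`.  Decided instances of an OPEN question (PLMS 2024 §1 p. 5); the
question in general, EC(3,2) and Zilber's EAC remain OPEN; NOT Schanuel's conjecture (neither
used nor implied); EAC ⇏ SC.
-/

noncomputable section

open Filter Topology Set Complex Polynomial
open Literature.NumberTheory.Transcendental Literature.ModelTheory.Zilber
open Literature.ModelTheory.ExponentialFields

set_option linter.dupNamespace false

namespace Summit.Schanuel.Schanuel.Theorems

section EllipticCurveDegenerate

/-! ## Part A. The curve `x₁² = x₀³ + 1` is irreducible (Eisenstein at `x₀ + 1`) -/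

/-- `(X + 1)² ∤ −(X³ + 1)` in `ℂ[X]` (the root `−1` of `X³ + 1` is simple). [folklore] -/
theorem X_add_one_sq_not_dvd_neg_X_pow_three_add_one :
    ¬ (Polynomial.X - Polynomial.C (-1 : ℂ)) ^ 2 ∣ (-(Polynomial.X ^ 3 + 1) : Polynomial ℂ) := by
  rintro ⟨q, hq⟩
  have hd := congrArg (fun p : Polynomial ℂ => (Polynomial.derivative p).eval (-1)) hq
  simp only [Polynomial.derivative_neg, Polynomial.derivative_add, Polynomial.derivative_one,
    add_zero, Polynomial.derivative_mul, Polynomial.derivative_pow,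
    Polynomial.derivative_sub, Polynomial.derivative_X, Polynomial.derivative_C, sub_zero, mul_one,
    Polynomial.eval_neg, Polynomial.eval_mul, Polynomial.eval_pow, Polynomial.eval_add,
    Polynomial.eval_sub, Polynomial.eval_X, Polynomial.eval_C,
    sub_neg_eq_add, neg_add_cancel] at hd
  norm_num at hd

/-- The relation `t² − (s³ + 1)` (the curve `x₁² = x₀³ + 1`, `s = x₀`, `t = x₁`) is irreducible in
`ℂ[s][t]` (Eisenstein at the prime `(s + 1)`). [folklore] -/
theorem irreducible_elliptic_row :
    Irreducible (Polynomial.X ^ 2 + Polynomial.C (-(Polynomial.X ^ 3 + 1) : Polynomial ℂ)) := by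
  set f : Polynomial (Polynomial ℂ) :=
    Polynomial.X ^ 2 + Polynomial.C (-(Polynomial.X ^ 3 + 1) : Polynomial ℂ) with hf
  set P : Ideal (Polynomial ℂ) := Ideal.span {Polynomial.X - Polynomial.C (-1 : ℂ)} with hP
  have hPprime : P.IsPrime := by
    rw [hP, Ideal.span_singleton_prime (Polynomial.X_sub_C_ne_zero (-1))]
    exact Polynomial.prime_X_sub_C (-1)
  have hmonic : f.Monic := by
    rw [hf]
    exact Polynomial.monic_X_pow_add_C _ (by norm_num)
  have hdeg : f.natDegree = 2 := by
    rw [hf, Polynomial.natDegree_X_pow_add_C]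
  have hdvd : (Polynomial.X - Polynomial.C (-1 : ℂ)) ∣ (-(Polynomial.X ^ 3 + 1) : Polynomial ℂ) := by
    rw [Polynomial.dvd_iff_isRoot]
    norm_num
  have heis : f.IsEisensteinAt P := by
    refine ⟨?_, fun {j} hj => ?_, ?_⟩
    · rw [hmonic.leadingCoeff]
      intro h1
      exact hPprime.ne_top ((Ideal.eq_top_iff_one P).2 h1)
    · rw [hdeg] at hj
      rw [hf, Polynomial.coeff_add, Polynomial.coeff_X_pow, if_neg (by omega), zero_add,
        Polynomial.coeff_C]
      split_ifs with h0
      · exact Ideal.mem_span_singleton.2 hdvd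
      · exact Ideal.zero_mem _
    · rw [hf, Polynomial.coeff_add, Polynomial.coeff_X_pow, if_neg (by omega), zero_add,
        Polynomial.coeff_C_zero, hP, Ideal.span_singleton_pow, Ideal.mem_span_singleton]
      exact X_add_one_sq_not_dvd_neg_X_pow_three_add_one
  exact heis.irreducible hPprime hmonic.isPrimitive (by rw [hdeg]; omega)

/-- Evaluation of `x₁² − x₀³ − 1`. -/
theorem eval_ellipticMv (x : Fin 2 → ℂ) :
    MvPolynomial.eval x (MvPolynomial.X 1 ^ 2 - MvPolynomial.X 0 ^ 3 - 1 : MvPolynomial (Fin 2) ℂ) =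
      x 1 ^ 2 - x 0 ^ 3 - 1 := by
  simp

/-- Rows form of the elliptic relation. -/
theorem eval_ellipticMv_rows (x y : ℂ) :
    MvPolynomial.eval ![x, y] (MvPolynomial.X 1 ^ 2 - MvPolynomial.X 0 ^ 3 - 1 : MvPolynomial (Fin 2) ℂ) =
      ((Polynomial.X ^ 2 + Polynomial.C (-(Polynomial.X ^ 3 + 1) : Polynomial ℂ)).map
        (Polynomial.evalRingHom x)).eval y := by
  rw [eval_ellipticMv]
  simp
  ring

/-- The curve `x₁² − x₀³ − 1` is irreducible in `ℂ[x₀, x₁]`. [folklore] -/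
theorem irreducible_ellipticMv :
    Irreducible (MvPolynomial.X 1 ^ 2 - MvPolynomial.X 0 ^ 3 - 1 : MvPolynomial (Fin 2) ℂ) :=
  (irreducible_rows_iff eval_ellipticMv_rows).2 irreducible_elliptic_row

/-! ## Part B. The place at infinity, the degenerate direction, the line witnesses -/

/-- The analytic data of the place: `Φ = √(1 + s⁶)` (principal), `Φ(0) = 1`, `Φ² = 1 + s⁶`
near `0`. [folklore] -/
theorem elliptic_branch_facts :
    ∃ Φ : ℂ → ℂ, AnalyticAt ℂ Φ 0 ∧ Φ 0 = 1 ∧ ∀ᶠ s in 𝓝 (0 : ℂ), Φ s ^ 2 = 1 + s ^ 6 := by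
  set u : ℂ → ℂ := fun s => 1 + s ^ 6 with hu
  have huan : AnalyticAt ℂ u 0 := analyticAt_const.add (analyticAt_id.pow 6)
  have hu0 : u 0 = 1 := by simp [hu]
  have hsmall : ∀ᶠ s in 𝓝 (0 : ℂ), ‖s ^ 6‖ < 1 := by
    have hc : ContinuousAt (fun s : ℂ => s ^ 6) 0 := continuousAt_id.pow 6
    have h := hc.tendsto
    simp only [ne_eq, OfNat.ofNat_ne_zero, not_false_eq_true, zero_pow] at h
    filter_upwards [(Metric.tendsto_nhds.1 h) 1 one_pos] with s hs
    rwa [dist_zero_right] at hs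
  set Φ : ℂ → ℂ := fun s => Complex.exp ((1 / 2 : ℂ) * Complex.log (1 + s ^ 6)) with hΦ
  have hΦan : AnalyticAt ℂ Φ 0 :=
    (analyticAt_const.mul (huan.clog (by rw [hu0]; exact Complex.one_mem_slitPlane))).cexp
  have hΦ0 : Φ 0 = 1 := by simp [hΦ]
  refine ⟨Φ, hΦan, hΦ0, ?_⟩
  filter_upwards [hsmall] with s hs
  have hslit : 1 + s ^ 6 ∈ Complex.slitPlane := Complex.mem_slitPlane_of_norm_lt_one hs
  have hne0 : 1 + s ^ 6 ≠ 0 := Complex.slitPlane_ne_zero hslit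
  rw [hΦ]
  simp only
  rw [← Complex.exp_nat_mul, ← mul_assoc, show ((2 : ℕ) : ℂ) * (1 / 2 : ℂ) = 1 by norm_num,
    one_mul]
  exact Complex.exp_log hne0

/-- **The elliptic curve is not contained in a line of rational slope**: one of `(0, 1)`,
`(0, −1)`, `(−1, 0)` lies off any given line `m₀x₀ + m₁x₁ = c`, `m ≠ 0`. [folklore] -/
theorem elliptic_exists_off_rationalLine (m : Fin 2 → ℤ) (hm : m ≠ 0) (c : ℂ) :
    ∃ x : Fin 2 → ℂ, MvPolynomial.eval x
        (MvPolynomial.X 1 ^ 2 - MvPolynomial.X 0 ^ 3 - 1 : MvPolynomial (Fin 2) ℂ) = 0 ∧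
      (m 0 : ℂ) * x 0 + (m 1 : ℂ) * x 1 ≠ c := by
  by_cases h1 : (m 0 : ℂ) * 0 + (m 1 : ℂ) * 1 ≠ c
  · exact ⟨![0, 1], by rw [eval_ellipticMv]; norm_num, by simpa using h1⟩
  by_cases h2 : (m 0 : ℂ) * 0 + (m 1 : ℂ) * (-1) ≠ c
  · exact ⟨![0, -1], by rw [eval_ellipticMv]; norm_num, by simpa using h2⟩
  push Not at h1 h2
  refine ⟨![-1, 0], by rw [eval_ellipticMv]; norm_num, ?_⟩
  simp only [Matrix.cons_val_zero, Matrix.cons_val_one, mul_zero, add_zero, mul_neg, mul_one]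
  intro h3
  have hm1 : (m 1 : ℂ) = 0 := by linear_combination (h1 - h2) / 2
  have hc : c = 0 := by rw [← h1]; simp [hm1]
  have hm0 : (m 0 : ℂ) = 0 := by linear_combination -h3 - hc
  apply hm
  funext i
  fin_cases i
  · exact_mod_cast hm0
  · exact_mod_cast hm1

/-! ## Part C. Case ∧ dense -/

/-- **THE ELLIPTIC CURVE `x₁² = x₀³ + 1`: every graph fibre `y₀ = R(x₀, x₁, y₁)` with
`R(x, 0) ≠ 0` somewhere on the curve and `R(x, t) ≠ 0` for some point of the curve and `t ≠ 0`
is in Mantova–Masser's case AND its unprojected exponential points are Zariski dense.**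
[cite: MantovaMasser2023, §1 Further remarks, p. 5 (the question, open in general)] (new) -/
theorem unprojectedDensityQuestion_ellipticCurve_relGraphFibre (R : MvPolynomial (Fin 3) ℂ)
    (hR0 : ∃ x : Fin 2 → ℂ, x 1 ^ 2 = x 0 ^ 3 + 1 ∧ MvPolynomial.eval ![x 0, x 1, 0] R ≠ 0)
    (hpt : ∃ (x : Fin 2 → ℂ) (t : ℂ), x 1 ^ 2 = x 0 ^ 3 + 1 ∧ t ≠ 0 ∧
      MvPolynomial.eval ![x 0, x 1, t] R ≠ 0) :
    MMCaseDimPiOneFree {w : Fin 2 ⊕ Fin 2 → ℂ |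
        MvPolynomial.eval ![w (Sum.inl 0), w (Sum.inl 1)]
          (MvPolynomial.X 1 ^ 2 - MvPolynomial.X 0 ^ 3 - 1 : MvPolynomial (Fin 2) ℂ) = 0 ∧
        w (Sum.inr 0) = MvPolynomial.eval ![w (Sum.inl 0), w (Sum.inl 1), w (Sum.inr 1)] R} ∧
      UnprojectedDense {w : Fin 2 ⊕ Fin 2 → ℂ |
        MvPolynomial.eval ![w (Sum.inl 0), w (Sum.inl 1)]
          (MvPolynomial.X 1 ^ 2 - MvPolynomial.X 0 ^ 3 - 1 : MvPolynomial (Fin 2) ℂ) = 0 ∧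
        w (Sum.inr 0) = MvPolynomial.eval ![w (Sum.inl 0), w (Sum.inl 1), w (Sum.inr 1)] R} := by
  classical
  set F : ℂ[X][X] := Polynomial.X ^ 2 + Polynomial.C (-(Polynomial.X ^ 3 + 1) : Polynomial ℂ)
    with hFdef
  have hFdeg : F.natDegree = 2 := by rw [hFdef, Polynomial.natDegree_X_pow_add_C]
  have hFeval : ∀ x₀ x₁ : ℂ, (F.map (Polynomial.evalRingHom x₀)).eval x₁ = x₁ ^ 2 - (x₀ ^ 3 + 1) := by
    intro x₀ x₁
    rw [hFdef]
    simp [Polynomial.map_add, Polynomial.map_pow, Polynomial.map_X, Polynomial.map_C]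
    ring
  -- the place `x₀ = s^{-2}`, `x₁ = Φ(s) s^{-3}`
  obtain ⟨Φ, hΦan, hΦ0, hΦsq⟩ := elliptic_branch_facts
  have hplace : ∀ᶠ s in 𝓝[≠] (0 : ℂ),
      (F.map (Polynomial.evalRingHom (s ^ 2)⁻¹)).eval (Φ s * (s ^ 3)⁻¹) = 0 := by
    filter_upwards [self_mem_nhdsWithin, nhdsWithin_le_nhds hΦsq] with s hs hΦs
    have hs' : (s : ℂ) ≠ 0 := hs
    rw [hFeval, mul_pow, hΦs]
    field_simp
    ring
  -- the direction `z = √π (1 + i)`: `z² = 2πi`, `Re(Φ(0) z³) = −2π√π`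
  set z : ℂ := (Real.sqrt Real.pi : ℂ) * (1 + I) with hzdef
  have hpi : ((Real.sqrt Real.pi : ℂ)) ^ 2 = Real.pi := by
    rw [← Complex.ofReal_pow, Real.sq_sqrt Real.pi_pos.le]
  have hz : z ^ 2 = 2 * Real.pi * I := by
    calc z ^ 2 = ((Real.sqrt Real.pi : ℂ)) ^ 2 * ((1 + I) ^ 2) := by rw [hzdef]; ring
      _ = Real.pi * (1 + 2 * I + I ^ 2) := by rw [hpi]; ring
      _ = 2 * Real.pi * I := by rw [Complex.I_sq]; ring
  have hdir : (Φ 0 * z ^ 3).re < 0 := by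
    have hz3 : z ^ 3 = 2 * Real.pi * I * z := by rw [pow_succ, hz]
    rw [hΦ0, one_mul, hz3, hzdef]
    have hre : (2 * (Real.pi : ℂ) * I * ((Real.sqrt Real.pi : ℂ) * (1 + I))).re =
        -(2 * Real.pi * Real.sqrt Real.pi) := by
      simp [Complex.mul_re, Complex.mul_im]
    rw [hre]
    have : 0 < Real.sqrt Real.pi := Real.sqrt_pos.2 Real.pi_pos
    nlinarith [Real.pi_pos]
  refine unprojectedDensityQuestion_relGraphFibre_of_degenerateDirection irreducible_ellipticMv F
    eval_ellipticMv_rows (by rw [hFdeg]; omega) (by norm_num : 1 ≤ 2) (by norm_num : 1 ≤ 3) hΦan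
    hplace hz hdir R ?_ ?_ elliptic_exists_off_rationalLine
  · obtain ⟨x, hx, hR⟩ := hR0
    exact ⟨x, by rw [eval_ellipticMv, hx]; ring, hR⟩
  · obtain ⟨x, t, hx, ht, hR⟩ := hpt
    exact ⟨x, t, by rw [eval_ellipticMv, hx]; ring, ht, hR⟩

/-- **`{x₁² = x₀³ + 1, y₀ + y₁ = 1}` — an elliptic base with no rational asymptote and
Mantova–Masser's unit-line fibre: case ∧ dense.** [cite: MantovaMasser2023, §1 Further
remarks, p. 5 (the question, open in general)] (new) -/
theorem unprojectedDensityQuestion_ellipticCurve_unitLine :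
    MMCaseDimPiOneFree {w : Fin 2 ⊕ Fin 2 → ℂ |
        w (Sum.inl 1) ^ 2 = w (Sum.inl 0) ^ 3 + 1 ∧ w (Sum.inr 0) + w (Sum.inr 1) = 1} ∧
      UnprojectedDense {w : Fin 2 ⊕ Fin 2 → ℂ |
        w (Sum.inl 1) ^ 2 = w (Sum.inl 0) ^ 3 + 1 ∧ w (Sum.inr 0) + w (Sum.inr 1) = 1} := by
  have e : {w : Fin 2 ⊕ Fin 2 → ℂ |
        MvPolynomial.eval ![w (Sum.inl 0), w (Sum.inl 1)]
          (MvPolynomial.X 1 ^ 2 - MvPolynomial.X 0 ^ 3 - 1 : MvPolynomial (Fin 2) ℂ) = 0 ∧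
        w (Sum.inr 0) = MvPolynomial.eval ![w (Sum.inl 0), w (Sum.inl 1), w (Sum.inr 1)]
          (1 - MvPolynomial.X 2 : MvPolynomial (Fin 3) ℂ)} =
      {w : Fin 2 ⊕ Fin 2 → ℂ |
        w (Sum.inl 1) ^ 2 = w (Sum.inl 0) ^ 3 + 1 ∧ w (Sum.inr 0) + w (Sum.inr 1) = 1} := by
    ext w
    simp only [Set.mem_setOf_eq, eval_ellipticMv, eval_oneSubY1, Matrix.cons_val_zero,
      Matrix.cons_val_one]
    have h2 : (![w (Sum.inl 0), w (Sum.inl 1), w (Sum.inr 1)] : Fin 3 → ℂ) 2 = w (Sum.inr 1) := rfl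
    rw [h2]
    constructor
    · rintro ⟨h1, h2⟩
      exact ⟨by linear_combination h1, by linear_combination h2⟩
    · rintro ⟨h1, h2⟩
      exact ⟨by linear_combination h1, by linear_combination h2⟩
  have h := unprojectedDensityQuestion_ellipticCurve_relGraphFibre (1 - MvPolynomial.X 2)
    ⟨![0, 1], by norm_num, by rw [eval_oneSubY1]; show (1 : ℂ) - 0 ≠ 0; norm_num⟩
    ⟨![0, 1], 2, by norm_num, two_ne_zero, by rw [eval_oneSubY1]; show (1 : ℂ) - 2 ≠ 0; norm_num⟩
  rw [e] at h
  exact h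

end EllipticCurveDegenerate

end Summit.Schanuel.Schanuel.Theorems

end
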